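import Mathlib.Analysis.Matrix.Spectrum
import Mathlib.Analysis.Matrix.PosDef
import Mathlib.LinearAlgebra.Matrix.GeneralLinearGroup.Defs
import Mathlib.Analysis.SpecialFunctions.Log.NegMulLog
import Mathlib.Analysis.SpecialFunctions.Pow.Real
import Mathlib.Analysis.Convex.StdSimplex
import Mathlib.Analysis.Convex.Jensen
import Literature.Computability.AlgebraicComplexity.MatrixMultiplicationExponent
import Literature.Computability.AlgebraicComplexity.AsymptoticSpectrum
import HarnessLib

/-!
# Quantum functionals: universal spectral points for complex 3-tensors

Topic: `Literature/Computability/AlgebraicComplexity`. Fact item `wi-04433` (MatrixMultiplication survey):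
the Christandl–Vrana–Zuiddam quantum functionals `F^θ`, the Strassen upper support functionals `ζ^θ`,
free tensors, and the theorems relating them, for coordinate 3-tensors `t : ι → κ → μ → ℂ` over
finite index types (the format of `triad`/`tensorRank`/`matMulTensor` in
`MatrixMultiplicationExponent.lean`). The source treats `k`-tensors for every `k ≥ 3`; everything here
is its case `k = 3`, where the three parameter sets `P_s(B) = P_nc(B) = P(B)` of the source coincide
with the probability simplex `P([3])` (CVZ, §3, "with equality if and only if `k ≤ 3`"), so `θ` is a
point of `stdSimplex ℝ (Fin 3)` throughout.

## Content (numbering of arXiv:1709.07851v3 = J. Amer. Math. Soc. 36 (2023))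

* `shannonEntropy P` — `H(P) = -∑ P(x) log₂ P(x)` (§2, p. 10); `marginalDist₁/₂/₃`, `weightedEntropy θ P
  = H_θ(P) = ∑ θ(i) H(P_i)` and `maxWeightedEntropy θ Φ = H_θ(Φ) = max_{P ∈ P(Φ)} H_θ(P)` (Def. 2.2).
* `actTensor A B C t` — the tensor `(A ⊗ B ⊗ C)·t` (change of bases / restriction, §1.1 and §3.2);
  `tensorSupport t` (Def. 2.1); `logUpperSupportFunctional θ t = ρ^θ(t) = min_C H_θ(supp_C t)` and
  `upperSupportFunctional θ t = ζ^θ(t) = 2^{ρ^θ(t)}` (`ζ^θ(0) = 0`) (Def. 2.3).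
* `IsFreeSet Φ`, `IsFree t` (Def. 4.17).
* `tensorNormSq`, `flatten₁/₂/₃`, `reducedDensity₁/₂/₃` (the unnormalised marginals `|t⟩⟨t|_j` of the
  pure state `t`), `marginalSpectrum₁/₂/₃` (their spectra divided by `⟨t|t⟩`), `quantumEntropy θ t =
  H_θ(t)` (Def. 3.15), `logQuantumFunctional θ t = E_θ(t) = sup_{(A,B,C) ∈ GL×GL×GL} H_θ((A⊗B⊗C)t)`
  and `quantumFunctional θ t = F^θ(t) = 2^{E_θ(t)}`, `F^θ(0) = 0` (Def. 3.16; for `k = 3` the upper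
  and lower quantum functionals coincide, Thm. 3.30, and this is the `F^θ` of the introduction, p. 4).
* `TensorDegeneratesTo s t` — `s ⊵ t`: `t` lies in the Euclidean closure of the
  `GL × GL × GL`-orbit of `s` (Rem. 1.2).
* Named facts (all `def … : Prop`, statements as printed, case `k = 3`):
  `Strassen1991_upperSupportFunctional` (Thm. 2.4, Strassen's theorem as quoted by CVZ),
  `ChristandlVranaZuiddam2023_unitTensor` (Thm. 3.19.1), `_directSum`, `_kronecker` (Cor. 3.31 with
  Thm. 3.5.2–3, Thm. 3.19.2–3, Thm. 3.30), `_restriction_mono` (Cor. 3.31, `≥`-monotone),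
  `_degeneration_mono` (Thm. 3.19.4), `_bounds` (Thm. 3.19.5), `_universalSpectralPoint` (Cor. 3.31,
  the main theorem: the conjunction of the four spectral-point properties),
  `_le_upperSupportFunctional` (Thm. 3.34: `ζ^θ(t) ≥ F^θ(t)`), `_free` (Thm. 4.20: equality for free
  tensors).

## Design choices and wording risks

* Direct sum, Kronecker product and unit tensor `⟨r⟩` are the tree's `directSumTensor`,
  `kroneckerTensor`, `unitTensor K r` (`AsymptoticSpectrum.lean`), so consumers of
  `subrank`/`asymptoticSubrank` can apply the facts by name; restriction is phrased with `actTensor`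
  (change of bases / `(A ⊗ B ⊗ C)·t`), which is the tree's `TensorRestrictsTo` by the bridge
  `tensorRestrictsTo_iff_exists_actTensor` (proved). `_universalSpectralPoint` is kept as the
  conjunction of the four properties rather than as `IsUniversalSpectralPoint (quantumFunctional θ)`:
  the tree's `SpectralMap` quantifies over all index types in `Type` without `Fintype`/`DecidableEq`,
  whereas `quantumFunctional` needs both (reduced density matrices and their spectra), so a
  `SpectralMap` cannot be built from it without junk branches.
* Bases versus `GL`: a `k`-tuple of bases `C ∈ C(t)` (Def. 2.1) is the same as a triple of invertible
  coordinate changes, and `supp_C t = tensorSupport ((A ⊗ B ⊗ C)·t)`; likewise Def. 3.16 takes the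
  supremum over `GL(V₁) × GL(V₂) × GL(V₃)` for fixed inner products, which in coordinates (standard inner
  product) is the supremum over `GL ι ℂ × GL κ ℂ × GL μ ℂ` used here.
* Junk values: `ρ^θ(0) = 0` and `E_θ(0) = 0` here (source: `-∞`); the exponentiated functionals are
  patched to `ζ^θ(0) = F^θ(0) = 0` exactly as in the source. `maxWeightedEntropy θ ∅ = sSup ∅ = 0`.
  The `iSup` in `E_θ` is over a family bounded above by `log₂|ι| + log₂|κ| + log₂|μ|`
  (`quantumEntropy_le`), and the `iInf` in `ρ^θ` over a family bounded below by `0`, so both are genuine.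
* Entropies are in bits (`log₂`), as in the source, so that `F^θ(⟨r⟩) = r`.
-/

noncomputable section

open scoped BigOperators Matrix ComplexOrder
open Real (negMulLog)

namespace Literature.Computability.AlgebraicComplexity

universe u

/-! ## Shannon entropy and `θ`-weighted marginal entropies (CVZ §2) -/

section Shannon

variable {α : Type*} [Fintype α]

/-- The Shannon entropy in bits `H(P) = -∑_x P(x) log₂ P(x)` of a finitely supported real function
(a probability distribution in the intended use), with `0 log₂ 0 = 0`.
[cite: ChristandlVranaZuiddam2023, §2 (p. 10)] -/
def shannonEntropy (P : α → ℝ) : ℝ :=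
  (∑ x, negMulLog (P x)) / Real.log 2

/-- Unfolding of `shannonEntropy`. [folklore] -/
theorem shannonEntropy_def (P : α → ℝ) :
    shannonEntropy P = (∑ x, negMulLog (P x)) / Real.log 2 := rfl

/-- `H(P) ≥ 0` when `0 ≤ P ≤ 1` pointwise. [folklore] -/
theorem shannonEntropy_nonneg {P : α → ℝ} (h0 : ∀ x, 0 ≤ P x) (h1 : ∀ x, P x ≤ 1) :
    0 ≤ shannonEntropy P :=
  div_nonneg (Finset.sum_nonneg fun x _ => Real.negMulLog_nonneg (h0 x) (h1 x))
    (Real.log_nonneg one_le_two)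

/-- A point of the probability simplex has entries `≤ 1`. [folklore] -/
theorem le_one_of_mem_stdSimplex {P : α → ℝ} (hP : P ∈ stdSimplex ℝ α) (x : α) : P x ≤ 1 := by
  rw [← hP.2]
  exact Finset.single_le_sum (fun i _ => hP.1 i) (Finset.mem_univ x)

/-- `H(P) ≥ 0` on the probability simplex. [folklore] -/
theorem shannonEntropy_nonneg_of_mem_stdSimplex {P : α → ℝ} (hP : P ∈ stdSimplex ℝ α) :
    0 ≤ shannonEntropy P :=
  shannonEntropy_nonneg hP.1 (le_one_of_mem_stdSimplex hP)

/-- `H(P) ≤ log₂ |α|` on the probability simplex (Jensen for the concave `-x log x`).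
[folklore] -/
theorem shannonEntropy_le_of_mem_stdSimplex {P : α → ℝ} (hP : P ∈ stdSimplex ℝ α) :
    shannonEntropy P ≤ Real.log (Fintype.card α) / Real.log 2 := by
  have hcard : 0 < (Fintype.card α : ℝ) := by
    rcases isEmpty_or_nonempty α with hα | hα
    · exfalso
      have := hP.2
      simp at this
    · exact_mod_cast Fintype.card_pos
  refine div_le_div_of_nonneg_right ?_ (Real.log_nonneg one_le_two)
  -- Jensen: `∑ (1/N) negMulLog (P x) ≤ negMulLog (∑ (1/N) P x) = negMulLog (1/N)`.
  have hJ := Real.concaveOn_negMulLog.le_map_sum (t := Finset.univ)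
    (w := fun _ : α => (Fintype.card α : ℝ)⁻¹) (p := P) (fun _ _ => by positivity)
    (by simp [Finset.card_univ, hcard.ne']) (fun i _ => Set.mem_Ici.2 (hP.1 i))
  simp only [smul_eq_mul, ← Finset.mul_sum, hP.2, mul_one] at hJ
  rw [Real.negMulLog, Real.log_inv, mul_neg, neg_mul, neg_neg] at hJ
  exact le_of_mul_le_mul_left hJ (inv_pos.2 hcard)

end Shannon

section Marginals

variable {ι κ μ : Type*} [Fintype ι] [Fintype κ] [Fintype μ]

/-- First marginal `P₁(a) = ∑_{b,c} P(a,b,c)` of a distribution on `ι × κ × μ`.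
[cite: ChristandlVranaZuiddam2023, §2 (p. 10)] -/
def marginalDist₁ (P : ι × κ × μ → ℝ) : ι → ℝ := fun a => ∑ b, ∑ c, P (a, b, c)

/-- Second marginal `P₂(b) = ∑_{a,c} P(a,b,c)`. [cite: ChristandlVranaZuiddam2023, §2 (p. 10)] -/
def marginalDist₂ (P : ι × κ × μ → ℝ) : κ → ℝ := fun b => ∑ a, ∑ c, P (a, b, c)

/-- Third marginal `P₃(c) = ∑_{a,b} P(a,b,c)`. [cite: ChristandlVranaZuiddam2023, §2 (p. 10)] -/
def marginalDist₃ (P : ι × κ × μ → ℝ) : μ → ℝ := fun c => ∑ a, ∑ b, P (a, b, c)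

/-- `H_θ(P) = θ(1) H(P₁) + θ(2) H(P₂) + θ(3) H(P₃)`, the `θ`-weighted average of the Shannon
entropies of the marginals (CVZ Def. 2.2; `θ` is indexed by `Fin 3 = {0,1,2}`).
[cite: ChristandlVranaZuiddam2023, Def. 2.2] -/
def weightedEntropy (θ : Fin 3 → ℝ) (P : ι × κ × μ → ℝ) : ℝ :=
  θ 0 * shannonEntropy (marginalDist₁ P) + θ 1 * shannonEntropy (marginalDist₂ P) +
    θ 2 * shannonEntropy (marginalDist₃ P)

/-- `H_θ(Φ) = max {H_θ(P) | P a probability distribution supported in Φ}` (CVZ Def. 2.2, (1)); a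
supremum of a bounded set, attained by compactness when `Φ ≠ ∅`; `H_θ(∅) = sSup ∅ = 0`.
[cite: ChristandlVranaZuiddam2023, Def. 2.2] -/
def maxWeightedEntropy (θ : Fin 3 → ℝ) (Φ : Set (ι × κ × μ)) : ℝ :=
  sSup (weightedEntropy θ '' {P | P ∈ stdSimplex ℝ (ι × κ × μ) ∧ Function.support P ⊆ Φ})

/-- No distribution is supported in `∅`, so `H_θ(∅)` is the junk value `0`. [folklore] -/
theorem maxWeightedEntropy_empty (θ : Fin 3 → ℝ) :
    maxWeightedEntropy θ (∅ : Set (ι × κ × μ)) = 0 := by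
  have : {P : ι × κ × μ → ℝ | P ∈ stdSimplex ℝ (ι × κ × μ) ∧ Function.support P ⊆ ∅} = ∅ := by
    ext P
    simp only [Set.subset_empty_iff, Function.support_eq_empty_iff, Set.mem_setOf_eq,
      Set.mem_empty_iff_false, iff_false, not_and]
    rintro hP rfl
    simpa using hP.2
  simp only [maxWeightedEntropy]
  rw [this, Set.image_empty, Real.sSup_empty]

/-- The marginals of a probability distribution are probability distributions. [folklore] -/
theorem marginalDist₁_mem_stdSimplex {P : ι × κ × μ → ℝ} (hP : P ∈ stdSimplex ℝ (ι × κ × μ)) :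
    marginalDist₁ P ∈ stdSimplex ℝ ι := by
  refine ⟨fun a => Finset.sum_nonneg fun b _ => Finset.sum_nonneg fun c _ => hP.1 _, ?_⟩
  simpa [marginalDist₁, Fintype.sum_prod_type] using hP.2

/-- The marginals of a probability distribution are probability distributions. [folklore] -/
theorem marginalDist₂_mem_stdSimplex {P : ι × κ × μ → ℝ} (hP : P ∈ stdSimplex ℝ (ι × κ × μ)) :
    marginalDist₂ P ∈ stdSimplex ℝ κ := by
  refine ⟨fun b => Finset.sum_nonneg fun a _ => Finset.sum_nonneg fun c _ => hP.1 _, ?_⟩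
  have h := hP.2
  simp only [Fintype.sum_prod_type] at h
  rw [Finset.sum_comm] at h
  simpa [marginalDist₂] using h

/-- The marginals of a probability distribution are probability distributions. [folklore] -/
theorem marginalDist₃_mem_stdSimplex {P : ι × κ × μ → ℝ} (hP : P ∈ stdSimplex ℝ (ι × κ × μ)) :
    marginalDist₃ P ∈ stdSimplex ℝ μ := by
  refine ⟨fun c => Finset.sum_nonneg fun a _ => Finset.sum_nonneg fun b _ => hP.1 _, ?_⟩
  have h := hP.2
  simp only [Fintype.sum_prod_type] at h
  change ∑ c, ∑ a, ∑ b, P (a, b, c) = 1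
  calc ∑ c, ∑ a, ∑ b, P (a, b, c) = ∑ a, ∑ c, ∑ b, P (a, b, c) := Finset.sum_comm
    _ = ∑ a, ∑ b, ∑ c, P (a, b, c) := Finset.sum_congr rfl fun a _ => Finset.sum_comm
    _ = 1 := h

/-- `0 ≤ H_θ(P) ≤ θ(1) log₂|ι| + θ(2) log₂|κ| + θ(3) log₂|μ|` for `θ ≥ 0` and `P` a probability
distribution (CVZ Thm. 2.4.5 in logarithmic form). [cite: ChristandlVranaZuiddam2023, Thm. 2.4.5] -/
theorem weightedEntropy_le {θ : Fin 3 → ℝ} (hθ : ∀ i, 0 ≤ θ i) {P : ι × κ × μ → ℝ}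
    (hP : P ∈ stdSimplex ℝ (ι × κ × μ)) :
    weightedEntropy θ P ≤ θ 0 * (Real.log (Fintype.card ι) / Real.log 2) +
      θ 1 * (Real.log (Fintype.card κ) / Real.log 2) + θ 2 * (Real.log (Fintype.card μ) / Real.log 2) :=
  add_le_add (add_le_add
    (mul_le_mul_of_nonneg_left (shannonEntropy_le_of_mem_stdSimplex (marginalDist₁_mem_stdSimplex hP))
      (hθ 0))
    (mul_le_mul_of_nonneg_left (shannonEntropy_le_of_mem_stdSimplex (marginalDist₂_mem_stdSimplex hP))
      (hθ 1)))
    (mul_le_mul_of_nonneg_left (shannonEntropy_le_of_mem_stdSimplex (marginalDist₃_mem_stdSimplex hP))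
      (hθ 2))

/-- `0 ≤ H_θ(P)` for `θ ≥ 0` and `P` a probability distribution. [folklore] -/
theorem weightedEntropy_nonneg {θ : Fin 3 → ℝ} (hθ : ∀ i, 0 ≤ θ i) {P : ι × κ × μ → ℝ}
    (hP : P ∈ stdSimplex ℝ (ι × κ × μ)) : 0 ≤ weightedEntropy θ P :=
  add_nonneg (add_nonneg
    (mul_nonneg (hθ 0) (shannonEntropy_nonneg_of_mem_stdSimplex (marginalDist₁_mem_stdSimplex hP)))
    (mul_nonneg (hθ 1) (shannonEntropy_nonneg_of_mem_stdSimplex (marginalDist₂_mem_stdSimplex hP))))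
    (mul_nonneg (hθ 2) (shannonEntropy_nonneg_of_mem_stdSimplex (marginalDist₃_mem_stdSimplex hP)))

/-- `0 ≤ H_θ(Φ)` for `θ ≥ 0`. [folklore] -/
theorem maxWeightedEntropy_nonneg {θ : Fin 3 → ℝ} (hθ : ∀ i, 0 ≤ θ i) (Φ : Set (ι × κ × μ)) :
    0 ≤ maxWeightedEntropy θ Φ := by
  refine Real.sSup_nonneg ?_
  rintro _ ⟨P, ⟨hP, -⟩, rfl⟩
  exact weightedEntropy_nonneg hθ hP

end Marginals

/-! ## The action of `(A, B, C)`, supports, and the Strassen upper support functional (CVZ §2.1) -/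

section Support

variable {K : Type*} {ι κ μ ι' κ' μ' : Type*} [Fintype ι] [Fintype κ] [Fintype μ]

/-- The tensor `(A ⊗ B ⊗ C)·t ∈ K^{ι'×κ'×μ'}` obtained from `t ∈ K^{ι×κ×μ}` by applying the linear
maps `A`, `B`, `C` in the three factors: entry `∑_{a',b',c'} A_{a a'} B_{b b'} C_{c c'} t_{a'b'c'}`.
For invertible square `A, B, C` this is a change of bases (`supp_C t` of CVZ Def. 2.1 is
`tensorSupport` of it); for arbitrary `A, B, C` the tensors of this form are the restrictions
`t ≥ (A ⊗ B ⊗ C)·t` of `t` (CVZ §1.1). [cite: ChristandlVranaZuiddam2023, §1.1 and Def. 2.1] -/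
def actTensor [CommSemiring K] (A : Matrix ι' ι K) (B : Matrix κ' κ K) (C : Matrix μ' μ K)
    (t : ι → κ → μ → K) : ι' → κ' → μ' → K :=
  fun a b c => ∑ a', ∑ b', ∑ c', A a a' * B b b' * C c c' * t a' b' c'

/-- Entries of `(A ⊗ B ⊗ C)·t`. [cite: ChristandlVranaZuiddam2023, §1.1] -/
theorem actTensor_apply [CommSemiring K] (A : Matrix ι' ι K) (B : Matrix κ' κ K) (C : Matrix μ' μ K)
    (t : ι → κ → μ → K) (a : ι') (b : κ') (c : μ') :
    actTensor A B C t a b c = ∑ a', ∑ b', ∑ c', A a a' * B b b' * C c c' * t a' b' c' := rfl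

/-- `(A ⊗ B ⊗ C)·0 = 0`. [folklore] -/
@[simp] theorem actTensor_zero [CommSemiring K] (A : Matrix ι' ι K) (B : Matrix κ' κ K)
    (C : Matrix μ' μ K) : actTensor A B C (0 : ι → κ → μ → K) = 0 := by
  funext a b c
  simp [actTensor]

/-- **Bridge to the tree's restriction preorder**: `t` restricts to `s` (`TensorRestrictsTo t s`,
`AsymptoticSpectrum.lean`: `s = (A ⊗ B ⊗ C)·t` entrywise for some linear maps) iff `s = actTensor A B C t`
for some matrices `A, B, C`. [folklore] -/
theorem tensorRestrictsTo_iff_exists_actTensor [CommSemiring K] (t : ι → κ → μ → K)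
    (s : ι' → κ' → μ' → K) :
    TensorRestrictsTo t s ↔
      ∃ (A : Matrix ι' ι K) (B : Matrix κ' κ K) (C : Matrix μ' μ K), s = actTensor A B C t := by
  constructor
  · rintro ⟨A, B, C, h⟩
    exact ⟨A, B, C, funext fun a => funext fun b => funext fun c => h a b c⟩
  · rintro ⟨A, B, C, rfl⟩
    exact ⟨A, B, C, fun _ _ _ => rfl⟩

/-- In particular `t` restricts to `(A ⊗ B ⊗ C)·t`. [folklore] -/
theorem tensorRestrictsTo_actTensor [CommSemiring K] (A : Matrix ι' ι K) (B : Matrix κ' κ K)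
    (C : Matrix μ' μ K) (t : ι → κ → μ → K) : TensorRestrictsTo t (actTensor A B C t) :=
  (tensorRestrictsTo_iff_exists_actTensor t _).2 ⟨A, B, C, rfl⟩

/-- `(1 ⊗ 1 ⊗ 1)·t = t`. [folklore] -/
@[simp] theorem actTensor_one [CommSemiring K] [DecidableEq ι] [DecidableEq κ] [DecidableEq μ]
    (t : ι → κ → μ → K) : actTensor (1 : Matrix ι ι K) (1 : Matrix κ κ K) (1 : Matrix μ μ K) t = t := by
  funext a b c
  simp [actTensor, Matrix.one_apply]

/-- A triad transforms factorwise: `(A ⊗ B ⊗ C)·(w ⊗ u ⊗ v) = (Aw) ⊗ (Bu) ⊗ (Cv)`. [folklore] -/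
theorem actTensor_triad [CommSemiring K] (A : Matrix ι' ι K) (B : Matrix κ' κ K) (C : Matrix μ' μ K)
    (w : ι → K) (u : κ → K) (v : μ → K) :
    actTensor A B C (triad w u v) = triad (A.mulVec w) (B.mulVec u) (C.mulVec v) := by
  funext a b c
  rw [actTensor_apply, triad_apply]
  have h₁ : A.mulVec w a = ∑ a', A a a' * w a' := rfl
  have h₂ : B.mulVec u b = ∑ b', B b b' * u b' := rfl
  have h₃ : C.mulVec v c = ∑ c', C c c' * v c' := rfl
  rw [h₁, h₂, h₃, Finset.sum_mul_sum, Finset.sum_mul]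
  refine Finset.sum_congr rfl fun a' _ => ?_
  rw [Finset.sum_mul_sum]
  refine Finset.sum_congr rfl fun b' _ => Finset.sum_congr rfl fun c' _ => ?_
  rw [triad_apply]
  ring

/-- The support `supp t = {(a,b,c) | t_{abc} ≠ 0}` of a coordinate tensor (CVZ Def. 2.1, for the
standard bases; `supp_C t` for other bases `C` is `tensorSupport (actTensor A B C t)` with `A, B, C`
the base-change matrices). [cite: ChristandlVranaZuiddam2023, Def. 2.1] -/
def tensorSupport (t : ι → κ → μ → K) [Zero K] : Set (ι × κ × μ) :=
  {p | t p.1 p.2.1 p.2.2 ≠ 0}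

omit [Fintype ι] [Fintype κ] [Fintype μ] in
/-- Membership in the support. [cite: ChristandlVranaZuiddam2023, Def. 2.1] -/
@[simp] theorem mem_tensorSupport [Zero K] (t : ι → κ → μ → K) (p : ι × κ × μ) :
    p ∈ tensorSupport t ↔ t p.1 p.2.1 p.2.2 ≠ 0 := Iff.rfl

omit [Fintype ι] [Fintype κ] [Fintype μ] in
/-- The zero tensor has empty support. [folklore] -/
@[simp] theorem tensorSupport_zero [Zero K] : tensorSupport (0 : ι → κ → μ → K) = ∅ := by
  ext p
  simp

omit [Fintype ι] [Fintype κ] [Fintype μ] in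
/-- The support is empty exactly for the zero tensor. [folklore] -/
theorem tensorSupport_eq_empty_iff [Zero K] (t : ι → κ → μ → K) : tensorSupport t = ∅ ↔ t = 0 := by
  constructor
  · intro h
    funext a b c
    by_contra hne
    have : (a, b, c) ∈ tensorSupport t := hne
    rw [h] at this
    exact this
  · rintro rfl
    exact tensorSupport_zero

variable [DecidableEq ι] [DecidableEq κ] [DecidableEq μ]

/-- **Logarithmic Strassen upper support functional** `ρ^θ(t) = min_{C ∈ C(t)} H_θ(supp_C t)`
(CVZ Def. 2.3), the minimum over all triples of bases, i.e. over all invertible coordinate changes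
`(A, B, C) ∈ GL × GL × GL`, of the maximal `θ`-weighted marginal entropy of a probability
distribution on the support. An infimum of a family bounded below by `0` (a minimum: the family of
supports is finite). Junk value `ρ^θ(0) = 0` (source: `-∞`).
[cite: ChristandlVranaZuiddam2023, Def. 2.3] -/
def logUpperSupportFunctional [Field K] (θ : Fin 3 → ℝ) (t : ι → κ → μ → K) : ℝ :=
  ⨅ g : GL ι K × GL κ K × GL μ K,
    maxWeightedEntropy θ (tensorSupport (actTensor (g.1 : Matrix ι ι K) (g.2.1 : Matrix κ κ K)
      (g.2.2 : Matrix μ μ K) t))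

/-- **Strassen upper support functional** `ζ^θ(t) = 2^{ρ^θ(t)}` for `t ≠ 0` and `ζ^θ(0) = 0`
(CVZ Def. 2.3). [cite: ChristandlVranaZuiddam2023, Def. 2.3] -/
def upperSupportFunctional [Field K] (θ : Fin 3 → ℝ) (t : ι → κ → μ → K) : ℝ :=
  open Classical in if t = 0 then 0 else (2 : ℝ) ^ logUpperSupportFunctional θ t

/-- `ζ^θ(0) = 0`. [cite: ChristandlVranaZuiddam2023, Def. 2.3] -/
@[simp] theorem upperSupportFunctional_zero [Field K] (θ : Fin 3 → ℝ) :
    upperSupportFunctional θ (0 : ι → κ → μ → K) = 0 := if_pos rfl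

/-- `ρ^θ(t) ≥ 0` for `θ ≥ 0`. [folklore] -/
theorem logUpperSupportFunctional_nonneg [Field K] {θ : Fin 3 → ℝ} (hθ : ∀ i, 0 ≤ θ i)
    (t : ι → κ → μ → K) : 0 ≤ logUpperSupportFunctional θ t :=
  Real.iInf_nonneg fun _ => maxWeightedEntropy_nonneg hθ _

/-- `ρ^θ(t) ≤ H_θ(supp t)`: the standard bases are one choice of bases. [folklore] -/
theorem logUpperSupportFunctional_le [Field K] {θ : Fin 3 → ℝ} (hθ : ∀ i, 0 ≤ θ i)
    (t : ι → κ → μ → K) : logUpperSupportFunctional θ t ≤ maxWeightedEntropy θ (tensorSupport t) := by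
  refine (ciInf_le ⟨0, ?_⟩ ((1 : GL ι K), (1 : GL κ K), (1 : GL μ K))).trans (le_of_eq ?_)
  · rintro _ ⟨g, rfl⟩
    exact maxWeightedEntropy_nonneg hθ _
  · simp

/-- `ζ^θ(t) ≥ 0`. [cite: ChristandlVranaZuiddam2023, Thm. 2.4.5] -/
theorem upperSupportFunctional_nonneg [Field K] (θ : Fin 3 → ℝ) (t : ι → κ → μ → K) :
    0 ≤ upperSupportFunctional θ t := by
  unfold upperSupportFunctional
  split_ifs
  · exact le_rfl
  · exact Real.rpow_nonneg zero_le_two _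

end Support

/-! ## Free tensors (CVZ §4.3) -/

section Free

variable {K : Type*} {ι κ μ : Type*}

/-- A set `Φ ⊆ ι × κ × μ` is *free* if any two distinct elements differ in at least two coordinates
(CVZ Def. 4.17), i.e. no two distinct elements agree in two coordinates: each of the three
projections to pairs of coordinates is injective on `Φ`. [cite: ChristandlVranaZuiddam2023, Def. 4.17] -/
def IsFreeSet (Φ : Set (ι × κ × μ)) : Prop :=
  Set.InjOn (fun p : ι × κ × μ => (p.1, p.2.1)) Φ ∧ Set.InjOn (fun p : ι × κ × μ => (p.1, p.2.2)) Φ ∧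
    Set.InjOn (fun p : ι × κ × μ => (p.2.1, p.2.2)) Φ

/-- Unfolding of `IsFreeSet` into the printed form: distinct elements of `Φ` do not agree in two of
the three coordinates. [cite: ChristandlVranaZuiddam2023, Def. 4.17] -/
theorem isFreeSet_iff (Φ : Set (ι × κ × μ)) :
    IsFreeSet Φ ↔ ∀ p ∈ Φ, ∀ q ∈ Φ, p ≠ q →
      ¬(p.1 = q.1 ∧ p.2.1 = q.2.1) ∧ ¬(p.1 = q.1 ∧ p.2.2 = q.2.2) ∧ ¬(p.2.1 = q.2.1 ∧ p.2.2 = q.2.2) := by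
  simp only [IsFreeSet, Set.InjOn, Prod.mk.injEq]
  constructor
  · rintro ⟨h₁, h₂, h₃⟩ p hp q hq hne
    exact ⟨fun h => hne (h₁ hp hq h), fun h => hne (h₂ hp hq h), fun h => hne (h₃ hp hq h)⟩
  · intro h
    refine ⟨fun p hp q hq e => ?_, fun p hp q hq e => ?_, fun p hp q hq e => ?_⟩ <;>
    · by_contra hne
      have := h p hp q hq hne
      tauto

/-- Subsets of free sets are free. [folklore] -/
theorem IsFreeSet.mono {Φ Ψ : Set (ι × κ × μ)} (h : IsFreeSet Ψ) (hΦ : Φ ⊆ Ψ) : IsFreeSet Φ :=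
  ⟨h.1.mono hΦ, h.2.1.mono hΦ, h.2.2.mono hΦ⟩

/-- The diagonal `{(a,a,a)}` (the support of a unit tensor) is free. [folklore] -/
theorem isFreeSet_diagonal (S : Set ι) : IsFreeSet {p : ι × ι × ι | p.1 ∈ S ∧ p.1 = p.2.1 ∧ p.2.1 = p.2.2} := by
  refine ⟨?_, ?_, ?_⟩ <;>
  · rintro ⟨a, b, c⟩ ⟨-, hab, hbc⟩ ⟨a', b', c'⟩ ⟨-, hab', hbc'⟩ h
    simp only [Prod.mk.injEq] at h hab hbc hab' hbc' ⊢
    subst hab hbc hab' hbc'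
    exact ⟨h.1, h.1, h.1⟩

variable [Fintype ι] [Fintype κ] [Fintype μ] [DecidableEq ι] [DecidableEq κ] [DecidableEq μ]

/-- A tensor is *free* if its support in some triple of bases is free (CVZ Def. 4.17), i.e.
`supp ((A ⊗ B ⊗ C)·t)` is free for some invertible `A, B, C`.
[cite: ChristandlVranaZuiddam2023, Def. 4.17] -/
def IsFree [Field K] (t : ι → κ → μ → K) : Prop :=
  ∃ g : GL ι K × GL κ K × GL μ K,
    IsFreeSet (tensorSupport (actTensor (g.1 : Matrix ι ι K) (g.2.1 : Matrix κ κ K)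
      (g.2.2 : Matrix μ μ K) t))

/-- A tensor whose support in the standard bases is free is free. [folklore] -/
theorem IsFree.of_isFreeSet [Field K] {t : ι → κ → μ → K} (h : IsFreeSet (tensorSupport t)) :
    IsFree t :=
  ⟨(1, 1, 1), by simpa using h⟩

end Free

/-! ## Quantum marginals, quantum entropy and the quantum functionals (CVZ §3.2) -/

section Quantum

variable {ι κ μ : Type*} [Fintype ι] [Fintype κ] [Fintype μ]

/-- `⟨t|t⟩ = ∑ |t_{abc}|²`, the squared norm of `t` as a vector of `ℂ^ι ⊗ ℂ^κ ⊗ ℂ^μ` with the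
standard inner products. [cite: ChristandlVranaZuiddam2023, Def. 3.15] -/
def tensorNormSq (t : ι → κ → μ → ℂ) : ℝ := ∑ a, ∑ b, ∑ c, ‖t a b c‖ ^ 2

/-- `⟨t|t⟩ ≥ 0`. [folklore] -/
theorem tensorNormSq_nonneg (t : ι → κ → μ → ℂ) : 0 ≤ tensorNormSq t :=
  Finset.sum_nonneg fun _ _ => Finset.sum_nonneg fun _ _ => Finset.sum_nonneg fun _ _ => sq_nonneg _

/-- `⟨t|t⟩ = 0 ↔ t = 0`. [folklore] -/
theorem tensorNormSq_eq_zero_iff (t : ι → κ → μ → ℂ) : tensorNormSq t = 0 ↔ t = 0 := by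
  constructor
  · intro h
    funext a b c
    have ha := (Finset.sum_eq_zero_iff_of_nonneg fun a _ =>
      Finset.sum_nonneg fun b _ => Finset.sum_nonneg fun c _ => sq_nonneg ‖t a b c‖).1 h a
      (Finset.mem_univ a)
    have hb := (Finset.sum_eq_zero_iff_of_nonneg fun b _ =>
      Finset.sum_nonneg fun c _ => sq_nonneg ‖t a b c‖).1 ha b (Finset.mem_univ b)
    have hc := (Finset.sum_eq_zero_iff_of_nonneg fun c _ => sq_nonneg ‖t a b c‖).1 hb c
      (Finset.mem_univ c)
    simpa using hc
  · rintro rfl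
    simp [tensorNormSq]

/-- The flattening `ι × (κ × μ)` of `t` (a `|ι| × |κ||μ|` matrix). [cite: ChristandlVranaZuiddam2023, Ex. 3.18] -/
def flatten₁ (t : ι → κ → μ → ℂ) : Matrix ι (κ × μ) ℂ := Matrix.of fun a p => t a p.1 p.2

/-- The flattening `κ × (ι × μ)` of `t`. [cite: ChristandlVranaZuiddam2023, Ex. 3.18] -/
def flatten₂ (t : ι → κ → μ → ℂ) : Matrix κ (ι × μ) ℂ := Matrix.of fun b p => t p.1 b p.2

/-- The flattening `μ × (ι × κ)` of `t`. [cite: ChristandlVranaZuiddam2023, Ex. 3.18] -/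
def flatten₃ (t : ι → κ → μ → ℂ) : Matrix μ (ι × κ) ℂ := Matrix.of fun c p => t p.1 p.2 c

/-- The unnormalised first quantum marginal `|t⟩⟨t|₁ = Tr₂₃ |t⟩⟨t|` of the pure state `t`, i.e. the
Gram matrix `M Mᴴ` of the first flattening `M`: entry `∑_{b,c} t_{abc} conj(t_{a'bc})`
(CVZ §3.2, "the `j`th marginal"). [cite: ChristandlVranaZuiddam2023, §3.2 (p. 23)] -/
def reducedDensity₁ (t : ι → κ → μ → ℂ) : Matrix ι ι ℂ := flatten₁ t * (flatten₁ t)ᴴ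

/-- The unnormalised second quantum marginal `|t⟩⟨t|₂`. [cite: ChristandlVranaZuiddam2023, §3.2 (p. 23)] -/
def reducedDensity₂ (t : ι → κ → μ → ℂ) : Matrix κ κ ℂ := flatten₂ t * (flatten₂ t)ᴴ

/-- The unnormalised third quantum marginal `|t⟩⟨t|₃`. [cite: ChristandlVranaZuiddam2023, §3.2 (p. 23)] -/
def reducedDensity₃ (t : ι → κ → μ → ℂ) : Matrix μ μ ℂ := flatten₃ t * (flatten₃ t)ᴴ

omit [Fintype ι] in
/-- Entries of `|t⟩⟨t|₁`. [folklore] -/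
theorem reducedDensity₁_apply (t : ι → κ → μ → ℂ) (a a' : ι) :
    reducedDensity₁ t a a' = ∑ b, ∑ c, t a b c * star (t a' b c) := by
  simp [reducedDensity₁, flatten₁, Matrix.mul_apply, Fintype.sum_prod_type]

omit [Fintype ι] in
/-- `|t⟩⟨t|₁` is Hermitian. [folklore] -/
theorem isHermitian_reducedDensity₁ (t : ι → κ → μ → ℂ) : (reducedDensity₁ t).IsHermitian :=
  Matrix.isHermitian_mul_conjTranspose_self _

omit [Fintype κ] in
/-- `|t⟩⟨t|₂` is Hermitian. [folklore] -/
theorem isHermitian_reducedDensity₂ (t : ι → κ → μ → ℂ) : (reducedDensity₂ t).IsHermitian :=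
  Matrix.isHermitian_mul_conjTranspose_self _

omit [Fintype μ] in
/-- `|t⟩⟨t|₃` is Hermitian. [folklore] -/
theorem isHermitian_reducedDensity₃ (t : ι → κ → μ → ℂ) : (reducedDensity₃ t).IsHermitian :=
  Matrix.isHermitian_mul_conjTranspose_self _

/-- `|t⟩⟨t|₁` is positive semidefinite. [folklore] -/
theorem posSemidef_reducedDensity₁ (t : ι → κ → μ → ℂ) : (reducedDensity₁ t).PosSemidef :=
  Matrix.posSemidef_self_mul_conjTranspose _

/-- `|t⟩⟨t|₂` is positive semidefinite. [folklore] -/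
theorem posSemidef_reducedDensity₂ (t : ι → κ → μ → ℂ) : (reducedDensity₂ t).PosSemidef :=
  Matrix.posSemidef_self_mul_conjTranspose _

/-- `|t⟩⟨t|₃` is positive semidefinite. [folklore] -/
theorem posSemidef_reducedDensity₃ (t : ι → κ → μ → ℂ) : (reducedDensity₃ t).PosSemidef :=
  Matrix.posSemidef_self_mul_conjTranspose _

/-- `Tr |t⟩⟨t|₁ = ⟨t|t⟩`. [folklore] -/
theorem trace_reducedDensity₁ (t : ι → κ → μ → ℂ) :
    (reducedDensity₁ t).trace = (tensorNormSq t : ℂ) := by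
  simp only [Matrix.trace, Matrix.diag, reducedDensity₁_apply, tensorNormSq, Complex.ofReal_sum]
  refine Finset.sum_congr rfl fun a _ => Finset.sum_congr rfl fun b _ =>
    Finset.sum_congr rfl fun c _ => ?_
  rw [Complex.star_def, Complex.mul_conj, Complex.normSq_eq_norm_sq, Complex.ofReal_pow]

/-- `Tr |t⟩⟨t|₂ = ⟨t|t⟩`. [folklore] -/
theorem trace_reducedDensity₂ (t : ι → κ → μ → ℂ) :
    (reducedDensity₂ t).trace = (tensorNormSq t : ℂ) := by
  simp only [Matrix.trace, Matrix.diag, reducedDensity₂, flatten₂, Matrix.mul_apply, Matrix.of_apply,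
    Matrix.conjTranspose_apply, Fintype.sum_prod_type, tensorNormSq, Complex.ofReal_sum]
  rw [Finset.sum_comm]
  refine Finset.sum_congr rfl fun a _ => Finset.sum_congr rfl fun b _ =>
    Finset.sum_congr rfl fun c _ => ?_
  rw [Complex.star_def, Complex.mul_conj, Complex.normSq_eq_norm_sq, Complex.ofReal_pow]

/-- `Tr |t⟩⟨t|₃ = ⟨t|t⟩`. [folklore] -/
theorem trace_reducedDensity₃ (t : ι → κ → μ → ℂ) :
    (reducedDensity₃ t).trace = (tensorNormSq t : ℂ) := by
  simp only [Matrix.trace, Matrix.diag, reducedDensity₃, flatten₃, Matrix.mul_apply, Matrix.of_apply,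
    Matrix.conjTranspose_apply, Fintype.sum_prod_type, tensorNormSq, Complex.ofReal_sum]
  calc ∑ c, ∑ a, ∑ b, t a b c * star (t a b c) = ∑ a, ∑ c, ∑ b, t a b c * star (t a b c) :=
        Finset.sum_comm
    _ = ∑ a, ∑ b, ∑ c, t a b c * star (t a b c) := Finset.sum_congr rfl fun a _ => Finset.sum_comm
    _ = _ := ?_
  refine Finset.sum_congr rfl fun a _ => Finset.sum_congr rfl fun b _ =>
    Finset.sum_congr rfl fun c _ => ?_
  rw [Complex.star_def, Complex.mul_conj, Complex.normSq_eq_norm_sq, Complex.ofReal_pow]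

variable [DecidableEq ι] [DecidableEq κ] [DecidableEq μ]

/-- The spectrum `r₁(t)` of the normalised first marginal `|t⟩⟨t|₁ / ⟨t|t⟩` (a probability
distribution on `ι` when `t ≠ 0`; the zero function for `t = 0`) (CVZ §3.4, `r_j(ψ)`).
[cite: ChristandlVranaZuiddam2023, §3.4 (p. 27)] -/
def marginalSpectrum₁ (t : ι → κ → μ → ℂ) : ι → ℝ :=
  fun i => (isHermitian_reducedDensity₁ t).eigenvalues i / tensorNormSq t

/-- The spectrum `r₂(t)` of the normalised second marginal. [cite: ChristandlVranaZuiddam2023, §3.4 (p. 27)] -/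
def marginalSpectrum₂ (t : ι → κ → μ → ℂ) : κ → ℝ :=
  fun i => (isHermitian_reducedDensity₂ t).eigenvalues i / tensorNormSq t

/-- The spectrum `r₃(t)` of the normalised third marginal. [cite: ChristandlVranaZuiddam2023, §3.4 (p. 27)] -/
def marginalSpectrum₃ (t : ι → κ → μ → ℂ) : μ → ℝ :=
  fun i => (isHermitian_reducedDensity₃ t).eigenvalues i / tensorNormSq t

omit [DecidableEq κ] [DecidableEq μ] in
/-- `r₁(t)` is a probability distribution for `t ≠ 0`. [folklore] -/
theorem marginalSpectrum₁_mem_stdSimplex {t : ι → κ → μ → ℂ} (ht : t ≠ 0) :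
    marginalSpectrum₁ t ∈ stdSimplex ℝ ι := by
  have hN : 0 < tensorNormSq t :=
    (tensorNormSq_nonneg t).lt_of_ne' (mt (tensorNormSq_eq_zero_iff t).1 ht)
  refine ⟨fun i => div_nonneg ((posSemidef_reducedDensity₁ t).eigenvalues_nonneg i) hN.le, ?_⟩
  change ∑ i, (isHermitian_reducedDensity₁ t).eigenvalues i / tensorNormSq t = 1
  rw [← Finset.sum_div, div_eq_one_iff_eq hN.ne']
  have h := (isHermitian_reducedDensity₁ t).trace_eq_sum_eigenvalues
  rw [trace_reducedDensity₁] at h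
  exact Complex.ofReal_injective (by rw [Complex.ofReal_sum]; exact h.symm)

omit [DecidableEq ι] [DecidableEq μ] in
/-- `r₂(t)` is a probability distribution for `t ≠ 0`. [folklore] -/
theorem marginalSpectrum₂_mem_stdSimplex {t : ι → κ → μ → ℂ} (ht : t ≠ 0) :
    marginalSpectrum₂ t ∈ stdSimplex ℝ κ := by
  have hN : 0 < tensorNormSq t :=
    (tensorNormSq_nonneg t).lt_of_ne' (mt (tensorNormSq_eq_zero_iff t).1 ht)
  refine ⟨fun i => div_nonneg ((posSemidef_reducedDensity₂ t).eigenvalues_nonneg i) hN.le, ?_⟩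
  change ∑ i, (isHermitian_reducedDensity₂ t).eigenvalues i / tensorNormSq t = 1
  rw [← Finset.sum_div, div_eq_one_iff_eq hN.ne']
  have h := (isHermitian_reducedDensity₂ t).trace_eq_sum_eigenvalues
  rw [trace_reducedDensity₂] at h
  exact Complex.ofReal_injective (by rw [Complex.ofReal_sum]; exact h.symm)

omit [DecidableEq ι] [DecidableEq κ] in
/-- `r₃(t)` is a probability distribution for `t ≠ 0`. [folklore] -/
theorem marginalSpectrum₃_mem_stdSimplex {t : ι → κ → μ → ℂ} (ht : t ≠ 0) :
    marginalSpectrum₃ t ∈ stdSimplex ℝ μ := by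
  have hN : 0 < tensorNormSq t :=
    (tensorNormSq_nonneg t).lt_of_ne' (mt (tensorNormSq_eq_zero_iff t).1 ht)
  refine ⟨fun i => div_nonneg ((posSemidef_reducedDensity₃ t).eigenvalues_nonneg i) hN.le, ?_⟩
  change ∑ i, (isHermitian_reducedDensity₃ t).eigenvalues i / tensorNormSq t = 1
  rw [← Finset.sum_div, div_eq_one_iff_eq hN.ne']
  have h := (isHermitian_reducedDensity₃ t).trace_eq_sum_eigenvalues
  rw [trace_reducedDensity₃] at h
  exact Complex.ofReal_injective (by rw [Complex.ofReal_sum]; exact h.symm)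

/-- `H_θ(t) = θ(1) H(r₁(t)) + θ(2) H(r₂(t)) + θ(3) H(r₃(t))`, the `θ`-weighted average of the
quantum (von Neumann) entropies of the one-particle marginals of the normalised pure state
`|t⟩⟨t| / ⟨t|t⟩` (CVZ Def. 3.15; for `k = 3` every bipartition is `{j} ⊔ [3]∖{j}` and the two
halves of a pure state have equal entropy). [cite: ChristandlVranaZuiddam2023, Def. 3.15] -/
def quantumEntropy (θ : Fin 3 → ℝ) (t : ι → κ → μ → ℂ) : ℝ :=
  θ 0 * shannonEntropy (marginalSpectrum₁ t) + θ 1 * shannonEntropy (marginalSpectrum₂ t) +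
    θ 2 * shannonEntropy (marginalSpectrum₃ t)

/-- `H_θ(0) = 0` (all marginal spectra are the zero function). [folklore] -/
@[simp] theorem quantumEntropy_zero (θ : Fin 3 → ℝ) : quantumEntropy θ (0 : ι → κ → μ → ℂ) = 0 := by
  have h0 : tensorNormSq (0 : ι → κ → μ → ℂ) = 0 := (tensorNormSq_eq_zero_iff _).2 rfl
  simp [quantumEntropy, marginalSpectrum₁, marginalSpectrum₂, marginalSpectrum₃, h0, shannonEntropy]

/-- `0 ≤ H_θ(t) ≤ θ(1) log₂|ι| + θ(2) log₂|κ| + θ(3) log₂|μ|` for `θ ≥ 0` (the entropy of a state on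
`ℂ^d` is at most `log₂ d`; CVZ Ex. 3.18 / Thm. 3.19.5 in logarithmic form).
[cite: ChristandlVranaZuiddam2023, Thm. 3.19.5] -/
theorem quantumEntropy_le {θ : Fin 3 → ℝ} (hθ : ∀ i, 0 ≤ θ i) (t : ι → κ → μ → ℂ) :
    quantumEntropy θ t ≤ θ 0 * (Real.log (Fintype.card ι) / Real.log 2) +
      θ 1 * (Real.log (Fintype.card κ) / Real.log 2) + θ 2 * (Real.log (Fintype.card μ) / Real.log 2) := by
  by_cases ht : t = 0
  · subst ht
    rw [quantumEntropy_zero]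
    have h2 : 0 ≤ Real.log 2 := Real.log_nonneg one_le_two
    have hl : ∀ n : ℕ, 0 ≤ Real.log n / Real.log 2 := fun n => by
      rcases Nat.eq_zero_or_pos n with rfl | hn
      · simp
      · exact div_nonneg (Real.log_nonneg (by exact_mod_cast hn)) h2
    exact add_nonneg (add_nonneg (mul_nonneg (hθ 0) (hl _)) (mul_nonneg (hθ 1) (hl _)))
      (mul_nonneg (hθ 2) (hl _))
  · exact add_le_add (add_le_add
      (mul_le_mul_of_nonneg_left (shannonEntropy_le_of_mem_stdSimplex
        (marginalSpectrum₁_mem_stdSimplex ht)) (hθ 0))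
      (mul_le_mul_of_nonneg_left (shannonEntropy_le_of_mem_stdSimplex
        (marginalSpectrum₂_mem_stdSimplex ht)) (hθ 1)))
      (mul_le_mul_of_nonneg_left (shannonEntropy_le_of_mem_stdSimplex
        (marginalSpectrum₃_mem_stdSimplex ht)) (hθ 2))

/-- `0 ≤ H_θ(t)` for `θ ≥ 0`. [folklore] -/
theorem quantumEntropy_nonneg {θ : Fin 3 → ℝ} (hθ : ∀ i, 0 ≤ θ i) (t : ι → κ → μ → ℂ) :
    0 ≤ quantumEntropy θ t := by
  by_cases ht : t = 0
  · subst ht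
    simp
  · exact add_nonneg (add_nonneg
      (mul_nonneg (hθ 0) (shannonEntropy_nonneg_of_mem_stdSimplex (marginalSpectrum₁_mem_stdSimplex ht)))
      (mul_nonneg (hθ 1) (shannonEntropy_nonneg_of_mem_stdSimplex (marginalSpectrum₂_mem_stdSimplex ht))))
      (mul_nonneg (hθ 2) (shannonEntropy_nonneg_of_mem_stdSimplex (marginalSpectrum₃_mem_stdSimplex ht)))

/-- **Logarithmic quantum functional** `E_θ(t) = sup_{(A,B,C)} H_θ((A ⊗ B ⊗ C)·t)`, the supremum over
invertible `A ∈ GL(ℂ^ι)`, `B ∈ GL(ℂ^κ)`, `C ∈ GL(ℂ^μ)` (CVZ Def. 3.16, with the standard inner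
products; equivalently the supremum over all choices of inner products, Rem. 3.17). A supremum of a
family bounded above (`quantumEntropy_le`), hence genuine; `E_θ(0) = 0` here (source: `-∞`). For
`k = 3` this is both the lower and the upper logarithmic quantum functional (Thm. 3.30).
[cite: ChristandlVranaZuiddam2023, Def. 3.16] -/
def logQuantumFunctional (θ : Fin 3 → ℝ) (t : ι → κ → μ → ℂ) : ℝ :=
  ⨆ g : GL ι ℂ × GL κ ℂ × GL μ ℂ,
    quantumEntropy θ (actTensor (g.1 : Matrix ι ι ℂ) (g.2.1 : Matrix κ κ ℂ) (g.2.2 : Matrix μ μ ℂ) t)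

/-- **Quantum functional** `F^θ(t) = 2^{E_θ(t)}` for `t ≠ 0`, `F^θ(0) = 0` (CVZ Def. 3.16 and p. 4;
`F^θ = F_θ` for `θ ∈ P_s(B)`, Thm. 3.30, which for 3-tensors is every `θ`).
[cite: ChristandlVranaZuiddam2023, Def. 3.16] -/
def quantumFunctional (θ : Fin 3 → ℝ) (t : ι → κ → μ → ℂ) : ℝ :=
  if t = 0 then 0 else (2 : ℝ) ^ logQuantumFunctional θ t

/-- `F^θ(0) = 0`. [cite: ChristandlVranaZuiddam2023, Def. 3.16] -/
@[simp] theorem quantumFunctional_zero (θ : Fin 3 → ℝ) :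
    quantumFunctional θ (0 : ι → κ → μ → ℂ) = 0 := if_pos rfl

/-- `F^θ(t) = 2^{E_θ(t)}` for `t ≠ 0`. [cite: ChristandlVranaZuiddam2023, Def. 3.16] -/
theorem quantumFunctional_of_ne_zero (θ : Fin 3 → ℝ) {t : ι → κ → μ → ℂ} (ht : t ≠ 0) :
    quantumFunctional θ t = (2 : ℝ) ^ logQuantumFunctional θ t := if_neg ht

/-- The family in the supremum defining `E_θ` is bounded above. [folklore] -/
theorem bddAbove_range_quantumEntropy {θ : Fin 3 → ℝ} (hθ : ∀ i, 0 ≤ θ i) (t : ι → κ → μ → ℂ) :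
    BddAbove (Set.range fun g : GL ι ℂ × GL κ ℂ × GL μ ℂ =>
      quantumEntropy θ (actTensor (g.1 : Matrix ι ι ℂ) (g.2.1 : Matrix κ κ ℂ) (g.2.2 : Matrix μ μ ℂ) t)) :=
  ⟨_, by
    rintro _ ⟨g, rfl⟩
    exact quantumEntropy_le hθ _⟩

/-- `H_θ((A ⊗ B ⊗ C)·t) ≤ E_θ(t)` for invertible `A, B, C`. [cite: ChristandlVranaZuiddam2023, Def. 3.16] -/
theorem quantumEntropy_actTensor_le_logQuantumFunctional {θ : Fin 3 → ℝ} (hθ : ∀ i, 0 ≤ θ i)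
    (t : ι → κ → μ → ℂ) (g : GL ι ℂ × GL κ ℂ × GL μ ℂ) :
    quantumEntropy θ (actTensor (g.1 : Matrix ι ι ℂ) (g.2.1 : Matrix κ κ ℂ) (g.2.2 : Matrix μ μ ℂ) t) ≤
      logQuantumFunctional θ t :=
  le_ciSup (bddAbove_range_quantumEntropy hθ t) g

/-- `H_θ(t) ≤ E_θ(t)` (take `A = B = C = 1`). [cite: ChristandlVranaZuiddam2023, Def. 3.16] -/
theorem quantumEntropy_le_logQuantumFunctional {θ : Fin 3 → ℝ} (hθ : ∀ i, 0 ≤ θ i)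
    (t : ι → κ → μ → ℂ) : quantumEntropy θ t ≤ logQuantumFunctional θ t := by
  simpa using quantumEntropy_actTensor_le_logQuantumFunctional hθ t (1, 1, 1)

/-- `0 ≤ E_θ(t) ≤ θ(1) log₂|ι| + θ(2) log₂|κ| + θ(3) log₂|μ|`, upper half.
[cite: ChristandlVranaZuiddam2023, Thm. 3.19.5] -/
theorem logQuantumFunctional_le {θ : Fin 3 → ℝ} (hθ : ∀ i, 0 ≤ θ i) (t : ι → κ → μ → ℂ) :
    logQuantumFunctional θ t ≤ θ 0 * (Real.log (Fintype.card ι) / Real.log 2) +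
      θ 1 * (Real.log (Fintype.card κ) / Real.log 2) + θ 2 * (Real.log (Fintype.card μ) / Real.log 2) :=
  ciSup_le fun _ => quantumEntropy_le hθ _

/-- `0 ≤ E_θ(t)`. [folklore] -/
theorem logQuantumFunctional_nonneg {θ : Fin 3 → ℝ} (hθ : ∀ i, 0 ≤ θ i) (t : ι → κ → μ → ℂ) :
    0 ≤ logQuantumFunctional θ t :=
  (quantumEntropy_nonneg hθ t).trans (quantumEntropy_le_logQuantumFunctional hθ t)

/-- `F^θ(t) ≥ 0`. [cite: ChristandlVranaZuiddam2023, Thm. 3.19.5] -/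
theorem quantumFunctional_nonneg (θ : Fin 3 → ℝ) (t : ι → κ → μ → ℂ) : 0 ≤ quantumFunctional θ t := by
  unfold quantumFunctional
  split_ifs
  · exact le_rfl
  · exact Real.rpow_nonneg zero_le_two _

/-- `F^θ(t) ≥ 1` for `t ≠ 0` and `θ ≥ 0`. [folklore] -/
theorem one_le_quantumFunctional {θ : Fin 3 → ℝ} (hθ : ∀ i, 0 ≤ θ i) {t : ι → κ → μ → ℂ}
    (ht : t ≠ 0) : 1 ≤ quantumFunctional θ t := by
  rw [quantumFunctional_of_ne_zero θ ht]
  exact Real.one_le_rpow one_le_two (logQuantumFunctional_nonneg hθ t)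

/-- **Degeneration** `s ⊵ t` of complex tensors of the same format: `t` lies in the Euclidean closure
of the orbit `(GL(ℂ^ι) × GL(ℂ^κ) × GL(ℂ^μ))·s` (CVZ Rem. 1.2; equivalently the Zariski closure).
[cite: ChristandlVranaZuiddam2023, Rem. 1.2] -/
def TensorDegeneratesTo (s t : ι → κ → μ → ℂ) : Prop :=
  t ∈ closure (Set.range fun g : GL ι ℂ × GL κ ℂ × GL μ ℂ =>
    actTensor (g.1 : Matrix ι ι ℂ) (g.2.1 : Matrix κ κ ℂ) (g.2.2 : Matrix μ μ ℂ) s)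

/-- `s ⊵ s`. [folklore] -/
theorem TensorDegeneratesTo.refl (s : ι → κ → μ → ℂ) : TensorDegeneratesTo s s :=
  subset_closure ⟨(1, 1, 1), by simp⟩

/-- Tensors in the orbit are degenerations: `s ⊵ (A ⊗ B ⊗ C)·s` for invertible `A, B, C`. [folklore] -/
theorem TensorDegeneratesTo.of_gl (s : ι → κ → μ → ℂ) (g : GL ι ℂ × GL κ ℂ × GL μ ℂ) :
    TensorDegeneratesTo s
      (actTensor (g.1 : Matrix ι ι ℂ) (g.2.1 : Matrix κ κ ℂ) (g.2.2 : Matrix μ μ ℂ) s) :=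
  subset_closure ⟨g, rfl⟩

end Quantum

/-! ## Named facts (CVZ §2–4, case `k = 3`) -/

section Facts

/-- **Strassen's theorem on the upper support functional** (CVZ Thm. 2.4, quoting [Str91]), over
any field `K`, `θ ∈ P([3])`, case `k = 3`:
(1) `ζ^θ(⟨r⟩) = r`; (2) `ζ^θ(s ⊕ t) = ζ^θ(s) + ζ^θ(t)`; (3) `ζ^θ(s ⊗ t) ≤ ζ^θ(s) ζ^θ(t)`;
(4) `s ≥ t ⇒ ζ^θ(s) ≥ ζ^θ(t)`; (5) `0 ≤ ζ^θ(t) ≤ |ι|^{θ(1)} |κ|^{θ(2)} |μ|^{θ(3)}`.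
Direct sum, Kronecker product and `⟨r⟩` are the tree's `directSumTensor`, `kroneckerTensor`,
`unitTensor`; restriction is `actTensor` (see `tensorRestrictsTo_iff_exists_actTensor`).
[cite: ChristandlVranaZuiddam2023, Thm. 2.4] -/
def Strassen1991_upperSupportFunctional : Prop :=
  ∀ (K : Type u) [Field K] (θ : Fin 3 → ℝ), θ ∈ stdSimplex ℝ (Fin 3) →
    -- (1) normalisation on unit tensors
    (∀ r : ℕ, upperSupportFunctional θ (unitTensor K r) = r) ∧
    -- (2) additivity under direct sum
    (∀ {ι κ μ ι' κ' μ' : Type u} [Fintype ι] [Fintype κ] [Fintype μ] [Fintype ι'] [Fintype κ']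
        [Fintype μ'] [DecidableEq ι] [DecidableEq κ] [DecidableEq μ] [DecidableEq ι'] [DecidableEq κ']
        [DecidableEq μ'] (s : ι → κ → μ → K) (t : ι' → κ' → μ' → K),
      upperSupportFunctional θ (directSumTensor s t) =
        upperSupportFunctional θ s + upperSupportFunctional θ t) ∧
    -- (3) sub-multiplicativity under the Kronecker product
    (∀ {ι κ μ ι' κ' μ' : Type u} [Fintype ι] [Fintype κ] [Fintype μ] [Fintype ι'] [Fintype κ']
        [Fintype μ'] [DecidableEq ι] [DecidableEq κ] [DecidableEq μ] [DecidableEq ι'] [DecidableEq κ']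
        [DecidableEq μ'] (s : ι → κ → μ → K) (t : ι' → κ' → μ' → K),
      upperSupportFunctional θ (kroneckerTensor s t) ≤
        upperSupportFunctional θ s * upperSupportFunctional θ t) ∧
    -- (4) monotone under restriction `s ≥ (A ⊗ B ⊗ C)·s`
    (∀ {ι κ μ ι' κ' μ' : Type u} [Fintype ι] [Fintype κ] [Fintype μ] [Fintype ι'] [Fintype κ']
        [Fintype μ'] [DecidableEq ι] [DecidableEq κ] [DecidableEq μ] [DecidableEq ι'] [DecidableEq κ']
        [DecidableEq μ'] (s : ι → κ → μ → K) (A : Matrix ι' ι K) (B : Matrix κ' κ K) (C : Matrix μ' μ K),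
      upperSupportFunctional θ (actTensor A B C s) ≤ upperSupportFunctional θ s) ∧
    -- (5) bounds
    (∀ {ι κ μ : Type u} [Fintype ι] [Fintype κ] [Fintype μ] [DecidableEq ι] [DecidableEq κ]
        [DecidableEq μ] (t : ι → κ → μ → K),
      0 ≤ upperSupportFunctional θ t ∧ upperSupportFunctional θ t ≤
        (Fintype.card ι : ℝ) ^ θ 0 * (Fintype.card κ : ℝ) ^ θ 1 * (Fintype.card μ : ℝ) ^ θ 2)

/-- **CVZ, normalisation** (Thm. 3.19.1 = Ex. 3.18, with Thm. 3.5.1): `F^θ(⟨r⟩) = r` for every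
`r ∈ ℕ` and `θ ∈ P([3])`, where `⟨r⟩ = unitTensor ℂ r`, `⟨r⟩_{abc} = [a = b = c]`.
[cite: ChristandlVranaZuiddam2023, Thm. 3.19.1] -/
def ChristandlVranaZuiddam2023_unitTensor : Prop :=
  ∀ (θ : Fin 3 → ℝ), θ ∈ stdSimplex ℝ (Fin 3) → ∀ r : ℕ,
    quantumFunctional θ (unitTensor ℂ r) = r

/-- **CVZ, additivity** (Cor. 3.31, from super-additivity Thm. 3.19.2, sub-additivity Thm. 3.5.2 and
`F^θ = F_θ` Thm. 3.30): `F^θ(s ⊕ t) = F^θ(s) + F^θ(t)` for `θ ∈ P([3])`, the direct sum being the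
block-diagonal tensor `directSumTensor s t` on `(ι ⊕ ι') × (κ ⊕ κ') × (μ ⊕ μ')`.
[cite: ChristandlVranaZuiddam2023, Cor. 3.31] -/
def ChristandlVranaZuiddam2023_directSum : Prop :=
  ∀ (θ : Fin 3 → ℝ), θ ∈ stdSimplex ℝ (Fin 3) →
    ∀ {ι κ μ ι' κ' μ' : Type u} [Fintype ι] [Fintype κ] [Fintype μ] [Fintype ι'] [Fintype κ']
      [Fintype μ'] [DecidableEq ι] [DecidableEq κ] [DecidableEq μ] [DecidableEq ι'] [DecidableEq κ']
      [DecidableEq μ'] (s : ι → κ → μ → ℂ) (t : ι' → κ' → μ' → ℂ),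
    quantumFunctional θ (directSumTensor s t) = quantumFunctional θ s + quantumFunctional θ t

/-- **CVZ, multiplicativity** (Cor. 3.31, from Thm. 3.19.3, Thm. 3.5.3 and Thm. 3.30):
`F^θ(s ⊗ t) = F^θ(s) F^θ(t)` for `θ ∈ P([3])`, `s ⊗ t = kroneckerTensor s t`,
`(s ⊗ t)_{(a,a')(b,b')(c,c')} = s_{abc} t_{a'b'c'}`.
[cite: ChristandlVranaZuiddam2023, Cor. 3.31] -/
def ChristandlVranaZuiddam2023_kronecker : Prop :=
  ∀ (θ : Fin 3 → ℝ), θ ∈ stdSimplex ℝ (Fin 3) →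
    ∀ {ι κ μ ι' κ' μ' : Type u} [Fintype ι] [Fintype κ] [Fintype μ] [Fintype ι'] [Fintype κ']
      [Fintype μ'] [DecidableEq ι] [DecidableEq κ] [DecidableEq μ] [DecidableEq ι'] [DecidableEq κ']
      [DecidableEq μ'] (s : ι → κ → μ → ℂ) (t : ι' → κ' → μ' → ℂ),
    quantumFunctional θ (kroneckerTensor s t) = quantumFunctional θ s * quantumFunctional θ t

/-- **CVZ, restriction monotonicity** (Cor. 3.31: `F^θ` is `≥`-monotone; §3, first paragraph):
`F^θ((A ⊗ B ⊗ C)·s) ≤ F^θ(s)` for all linear maps `A, B, C` (any formats) and `θ ∈ P([3])`;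
equivalently `TensorRestrictsTo s t → F^θ(t) ≤ F^θ(s)` (`tensorRestrictsTo_iff_exists_actTensor`,
corollary `ChristandlVranaZuiddam2023_restriction_mono.of_tensorRestrictsTo`).
[cite: ChristandlVranaZuiddam2023, Cor. 3.31] -/
def ChristandlVranaZuiddam2023_restriction_mono : Prop :=
  ∀ (θ : Fin 3 → ℝ), θ ∈ stdSimplex ℝ (Fin 3) →
    ∀ {ι κ μ ι' κ' μ' : Type u} [Fintype ι] [Fintype κ] [Fintype μ] [Fintype ι'] [Fintype κ']
      [Fintype μ'] [DecidableEq ι] [DecidableEq κ] [DecidableEq μ] [DecidableEq ι'] [DecidableEq κ']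
      [DecidableEq μ'] (s : ι → κ → μ → ℂ) (A : Matrix ι' ι ℂ) (B : Matrix κ' κ ℂ) (C : Matrix μ' μ ℂ),
    quantumFunctional θ (actTensor A B C s) ≤ quantumFunctional θ s

/-- **CVZ, degeneration monotonicity** (Thm. 3.19.4 = Lemma 3.20): if `s ⊵ t` then
`F^θ(s) ≥ F^θ(t)`, `θ ∈ P([3])`. [cite: ChristandlVranaZuiddam2023, Thm. 3.19.4] -/
def ChristandlVranaZuiddam2023_degeneration_mono : Prop :=
  ∀ (θ : Fin 3 → ℝ), θ ∈ stdSimplex ℝ (Fin 3) →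
    ∀ {ι κ μ : Type u} [Fintype ι] [Fintype κ] [Fintype μ] [DecidableEq ι] [DecidableEq κ]
      [DecidableEq μ] (s t : ι → κ → μ → ℂ), TensorDegeneratesTo s t →
    quantumFunctional θ t ≤ quantumFunctional θ s

/-- **CVZ, bounds** (Thm. 3.19.5, `k = 3`: the bipartitions are `{1}|{2,3}`, `{2}|{1,3}`, `{3}|{1,2}`):
`0 ≤ F^θ(t) ≤ ∏_j min(dim V_j, dim V_{[3]∖j})^{θ(j)}`.
[cite: ChristandlVranaZuiddam2023, Thm. 3.19.5] -/
def ChristandlVranaZuiddam2023_bounds : Prop :=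
  ∀ (θ : Fin 3 → ℝ), θ ∈ stdSimplex ℝ (Fin 3) →
    ∀ {ι κ μ : Type u} [Fintype ι] [Fintype κ] [Fintype μ] [DecidableEq ι] [DecidableEq κ]
      [DecidableEq μ] (t : ι → κ → μ → ℂ),
    0 ≤ quantumFunctional θ t ∧ quantumFunctional θ t ≤
      (min (Fintype.card ι) (Fintype.card κ * Fintype.card μ) : ℝ) ^ θ 0 *
        (min (Fintype.card κ) (Fintype.card ι * Fintype.card μ) : ℝ) ^ θ 1 *
        (min (Fintype.card μ) (Fintype.card ι * Fintype.card κ) : ℝ) ^ θ 2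

/-- **CVZ main theorem: the quantum functionals are universal spectral points** (Cor. 3.31; abstract
and §1.3.1): for every `θ ∈ P([3])`, `F^θ` on complex 3-tensors is normalised on `⟨r⟩`, additive
under `⊕`, multiplicative under `⊗` and monotone under restriction — the four defining properties of a
point of the asymptotic spectrum `Δ(T)` of all complex 3-tensors (§1.2, p. 7).
[cite: ChristandlVranaZuiddam2023, Cor. 3.31] -/
def ChristandlVranaZuiddam2023_universalSpectralPoint : Prop :=
  ChristandlVranaZuiddam2023_unitTensor ∧ ChristandlVranaZuiddam2023_directSum.{u} ∧
    ChristandlVranaZuiddam2023_kronecker.{u} ∧ ChristandlVranaZuiddam2023_restriction_mono.{u}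

/-- The main theorem yields each of the four properties. [cite: ChristandlVranaZuiddam2023, Cor. 3.31] -/
theorem ChristandlVranaZuiddam2023_universalSpectralPoint.unitTensor
    (h : ChristandlVranaZuiddam2023_universalSpectralPoint.{u}) : ChristandlVranaZuiddam2023_unitTensor :=
  h.1

/-- The main theorem yields each of the four properties. [cite: ChristandlVranaZuiddam2023, Cor. 3.31] -/
theorem ChristandlVranaZuiddam2023_universalSpectralPoint.directSum
    (h : ChristandlVranaZuiddam2023_universalSpectralPoint.{u}) :
    ChristandlVranaZuiddam2023_directSum.{u} :=
  h.2.1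

/-- The main theorem yields each of the four properties. [cite: ChristandlVranaZuiddam2023, Cor. 3.31] -/
theorem ChristandlVranaZuiddam2023_universalSpectralPoint.kronecker
    (h : ChristandlVranaZuiddam2023_universalSpectralPoint.{u}) :
    ChristandlVranaZuiddam2023_kronecker.{u} :=
  h.2.2.1

/-- The main theorem yields each of the four properties. [cite: ChristandlVranaZuiddam2023, Cor. 3.31] -/
theorem ChristandlVranaZuiddam2023_universalSpectralPoint.restriction_mono
    (h : ChristandlVranaZuiddam2023_universalSpectralPoint.{u}) :
    ChristandlVranaZuiddam2023_restriction_mono.{u} :=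
  h.2.2.2

/-- Restriction monotonicity in the tree's `TensorRestrictsTo` form: if `s ≥ t` then `F^θ(t) ≤ F^θ(s)`.
[cite: ChristandlVranaZuiddam2023, Cor. 3.31] -/
theorem ChristandlVranaZuiddam2023_restriction_mono.of_tensorRestrictsTo
    (h : ChristandlVranaZuiddam2023_restriction_mono.{u}) {θ : Fin 3 → ℝ}
    (hθ : θ ∈ stdSimplex ℝ (Fin 3)) {ι κ μ ι' κ' μ' : Type u} [Fintype ι] [Fintype κ] [Fintype μ]
    [Fintype ι'] [Fintype κ'] [Fintype μ'] [DecidableEq ι] [DecidableEq κ] [DecidableEq μ]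
    [DecidableEq ι'] [DecidableEq κ'] [DecidableEq μ'] {s : ι → κ → μ → ℂ} {t : ι' → κ' → μ' → ℂ}
    (hst : TensorRestrictsTo s t) : quantumFunctional θ t ≤ quantumFunctional θ s := by
  obtain ⟨A, B, C, rfl⟩ := (tensorRestrictsTo_iff_exists_actTensor s t).1 hst
  exact h θ hθ s A B C

/-- **CVZ Thm. 3.34: the upper support functional dominates the quantum functional**,
`ρ^θ(t) ≥ E^θ(t)` (upper quantum functional), and `E^θ(t) = E_θ(t)` for `θ ∈ P_s(B)` (Thm. 3.30),
hence `ρ^θ(t) ≥ E_θ(t)` and `ζ^θ(t) ≥ F^θ(t)` for `θ ∈ P([3])` and every complex 3-tensor `t`.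
[cite: ChristandlVranaZuiddam2023, Thm. 3.34 and Thm. 3.30] -/
def ChristandlVranaZuiddam2023_le_upperSupportFunctional : Prop :=
  ∀ (θ : Fin 3 → ℝ), θ ∈ stdSimplex ℝ (Fin 3) →
    ∀ {ι κ μ : Type u} [Fintype ι] [Fintype κ] [Fintype μ] [DecidableEq ι] [DecidableEq κ]
      [DecidableEq μ] (t : ι → κ → μ → ℂ),
    logQuantumFunctional θ t ≤ logUpperSupportFunctional θ t ∧
      quantumFunctional θ t ≤ upperSupportFunctional θ t

/-- **CVZ Thm. 4.20: for free tensors the support and quantum functionals coincide**,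
`ρ^θ(t) = E^θ(t) = E_θ(t)`, hence `ζ^θ(t) = F^θ(t)`, for `t` free and `θ ∈ P([3])`.
[cite: ChristandlVranaZuiddam2023, Thm. 4.20] -/
def ChristandlVranaZuiddam2023_free : Prop :=
  ∀ (θ : Fin 3 → ℝ), θ ∈ stdSimplex ℝ (Fin 3) →
    ∀ {ι κ μ : Type u} [Fintype ι] [Fintype κ] [Fintype μ] [DecidableEq ι] [DecidableEq κ]
      [DecidableEq μ] (t : ι → κ → μ → ℂ), IsFree t →
    logUpperSupportFunctional θ t = logQuantumFunctional θ t ∧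
      upperSupportFunctional θ t = quantumFunctional θ t

/-- Consequence of the main theorem used for obstructions (CVZ §1.1, properties (a),(b)): a
universal spectral point separates restrictions — if `F^θ((A ⊗ B ⊗ C)·s) > F^θ(s)` were possible the
functional would not be monotone; contrapositive form. [cite: ChristandlVranaZuiddam2023, §1.1 (p. 4)] -/
theorem ChristandlVranaZuiddam2023_restriction_mono.ne_actTensor
    (h : ChristandlVranaZuiddam2023_restriction_mono.{u}) {θ : Fin 3 → ℝ} (hθ : θ ∈ stdSimplex ℝ (Fin 3))
    {ι κ μ ι' κ' μ' : Type u} [Fintype ι] [Fintype κ] [Fintype μ] [Fintype ι'] [Fintype κ']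
    [Fintype μ'] [DecidableEq ι] [DecidableEq κ] [DecidableEq μ] [DecidableEq ι'] [DecidableEq κ']
    [DecidableEq μ'] {s : ι → κ → μ → ℂ} {t : ι' → κ' → μ' → ℂ}
    (hlt : quantumFunctional θ s < quantumFunctional θ t) (A : Matrix ι' ι ℂ) (B : Matrix κ' κ ℂ)
    (C : Matrix μ' μ ℂ) : actTensor A B C s ≠ t := by
  rintro rfl
  have h' : quantumFunctional θ (actTensor A B C s) ≤ quantumFunctional θ s := h θ hθ s A B C
  exact (not_lt.2 h') hlt

/-- With Thm. 3.34 and Thm. 3.19.1: `ζ^θ` and `F^θ` agree on unit tensors, both equal to `r`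
(unit tensors are free, `isFreeSet_diagonal`). A consistency check between the vendored facts.
[cite: ChristandlVranaZuiddam2023, Thm. 4.20] -/
theorem ChristandlVranaZuiddam2023_free.upperSupportFunctional_unitTensor
    (h : ChristandlVranaZuiddam2023_free.{0}) (hu : ChristandlVranaZuiddam2023_unitTensor)
    {θ : Fin 3 → ℝ} (hθ : θ ∈ stdSimplex ℝ (Fin 3)) (r : ℕ) :
    upperSupportFunctional θ (fun a b c : Fin r => if a = b ∧ b = c then (1 : ℂ) else 0) = r := by
  rw [← hu θ hθ r]
  refine (h θ hθ _ (IsFree.of_isFreeSet ?_)).2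
  refine (isFreeSet_diagonal (Set.univ : Set (Fin r))).mono ?_
  rintro ⟨a, b, c⟩ hp
  simp only [mem_tensorSupport, ne_eq, ite_eq_right_iff, one_ne_zero, imp_false, not_not] at hp
  exact ⟨Set.mem_univ _, hp.1, hp.2⟩

end Facts

end Literature.Computability.AlgebraicComplexity

end
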